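import Summits.BirchSwinnertonDyer.BirchSwinnertonDyer.Theorems.ClassRecordThreeEulerHalvesAtThreeCartanSupplyTraceTools
import HarnessLib

/-!
# The `S₃`-descent lemma for permutation modules: the trace on `Y = ker(1 + R + R²) ∩ ker(J − 1)`

Helper file `--supports stmt-BirchSwinnertonDyer-23422` (seat `bsd-stepL-tam3-p1` g23, LINE OWNER of crux 23422 `EulerHalvesAtThreeResidualUpperBound`,
line `cartan` v11), serving the registered stub (SUPPLY) `stub_cartanTorusLatticeSupply : CartanCorrespondence.CartanTorusLatticeSupply` via the road
`HOME/tam3-p1/g23/SUPPLY-ROAD-GG1.md` §1: the honest lattices `Y_s ⊂ ℤ[G/H_s]` (principal-series places) and `Y_ns ⊂ ℤ[G/H₃]` (cuspidal places), whose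
characters enter `χ_W = χ_{Y_s} − χ_{GG₁}` resp. `χ_W = χ_{GG₁} − χ_{Y_ns}`, are both instances of ONE construction: a finite `G`-set `X` carrying a
commuting action of `S₃ = ⟨R, J ∣ R³ = 1, J² = 1, JRJ = R⁻¹⟩` (deck transformation `R` of a cubic cover, an involution `J` from the normaliser of the
torus), and `Y := {f : X → K ∣ f + f∘R + f∘R² = 0, f∘J = f}`. THIS FILE proves, for every permutation `g` of `X` commuting with `R` and `J`, the
trace formula **`6 · tr(g | Y) = 2·#Fix(g) − #Fix(R g) − #Fix(R² g)`** (`six_mul_trace_restrict_descent`), over any field `K` with `2 ≠ 0`, `3 ≠ 0`,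
by pure algebra in `End(K^X)`: with the commuting idempotents `e₁ = (1+R+R²)/3`, `e₂ = 1 − e₁`, `e± = (1 ± J)/2` and `φ := R − R²` one has `φ² = −3e₂`,
`φ e₋ = e₊ φ`, hence `tr(g e₂ e₋) = tr(g e₂ e₊)` (cyclicity), `tr(g e₂) = 2 tr(g e₂ e₊)`, `3 tr(g e₁) = tr g + tr gR + tr gR²`, and `tr(g e₂ e₊) = tr(g | Y)`
since `e₂ e₊` is an idempotent onto `Y`; traces of permutation operators are fixed-point counts (`TraceTools.trace_funLeft_perm`).
No definitions: `Y` is written out as `ker(1 + P_R + P_R²) ⊓ ker(P_J − 1)` with `P_τ = LinearMap.funLeft K K τ` (`f ↦ f ∘ τ`).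
HONEST FRAMING: generic linear algebra; nothing about `GL₂(𝔽_q)`, SUPPLY, NUM, crux 23422 ∕ 19109 is proved here; BSD is proved for no curve. [folklore]
-/

namespace Summit.BirchSwinnertonDyer.BirchSwinnertonDyer.Theorems.CartanSupply.DihedralDescent

open Module LinearMap
open Summit.BirchSwinnertonDyer.BirchSwinnertonDyer.Theorems.CartanSupply.TraceTools

set_option linter.dupNamespace false
set_option autoImplicit false

variable {K : Type*} [Field K] {X : Type*} [Fintype X] [DecidableEq X]

omit [Fintype X] [DecidableEq X] in
/-- PROVED: `funLeft` is anti-multiplicative on permutations: `(f ∘ (σ τ)) = ((f ∘ σ) ∘ τ)`. [folklore] -/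
theorem funLeft_perm_mul (σ τ : Equiv.Perm X) :
    (LinearMap.funLeft K K (σ * τ : Equiv.Perm X) : Module.End K (X → K)) = LinearMap.funLeft K K τ * LinearMap.funLeft K K σ := by
  apply LinearMap.ext; intro f; funext x; rfl

omit [Fintype X] [DecidableEq X] in
/-- PROVED: membership in `Y`, pointwise. [folklore] -/
theorem mem_Y (R J : Equiv.Perm X) (f : X → K) :
    f ∈ (LinearMap.ker (1 + LinearMap.funLeft K K R + LinearMap.funLeft K K R * LinearMap.funLeft K K R : Module.End K (X → K)) ⊓
      LinearMap.ker (LinearMap.funLeft K K J - 1 : Module.End K (X → K))) ↔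
      ((∀ x, f x + f (R x) + f (R (R x)) = 0) ∧ ∀ x, f (J x) = f x) := by
  simp only [Submodule.mem_inf, LinearMap.mem_ker]
  constructor
  · rintro ⟨h1, h2⟩
    refine ⟨fun x => ?_, fun x => ?_⟩
    · have := congrFun h1 x
      simpa using this
    · have := congrFun h2 x
      simpa [sub_eq_zero] using this
  · rintro ⟨h1, h2⟩
    refine ⟨?_, ?_⟩
    · funext x; simpa using h1 x
    · funext x; simp [h2 x]

omit [Fintype X] [DecidableEq X] in
/-- PROVED: a permutation commuting with `R` and `J` preserves `Y`. [folklore] -/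
theorem mapsTo_Y {R J g : Equiv.Perm X} (hgR : g * R = R * g) (hgJ : g * J = J * g) :
    ∀ f ∈ (LinearMap.ker (1 + LinearMap.funLeft K K R + LinearMap.funLeft K K R * LinearMap.funLeft K K R : Module.End K (X → K)) ⊓
      LinearMap.ker (LinearMap.funLeft K K J - 1 : Module.End K (X → K))),
      LinearMap.funLeft K K g f ∈ (LinearMap.ker (1 + LinearMap.funLeft K K R + LinearMap.funLeft K K R * LinearMap.funLeft K K R : Module.End K (X → K)) ⊓
      LinearMap.ker (LinearMap.funLeft K K J - 1 : Module.End K (X → K))) := by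
  intro f hf
  rw [mem_Y] at hf ⊢
  have hRg : ∀ x, R (g x) = g (R x) := fun x => by
    have := Equiv.ext_iff.mp hgR x; simpa using this.symm
  have hJg : ∀ x, J (g x) = g (J x) := fun x => by
    have := Equiv.ext_iff.mp hgJ x; simpa using this.symm
  refine ⟨fun x => ?_, fun x => ?_⟩
  · simp only [LinearMap.funLeft_apply, ← hRg]
    exact hf.1 (g x)
  · simp only [LinearMap.funLeft_apply, ← hJg]
    exact hf.2 (g x)

/-- PROVED — **THE `S₃`-DESCENT TRACE FORMULA**: for permutations `R, J` of a finite set `X` with `R³ = 1`, `J² = 1`, `JRJ = R⁻¹`, and a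
permutation `g` commuting with both, the subspace `Y = {f ∣ f + f∘R + f∘R² = 0, f∘J = f}` of `K^X` (`2, 3 ≠ 0` in `K`) satisfies
`6 · tr(g | Y) = 2·#Fix(g) − #Fix(R·g) − #Fix(R²·g)`. [folklore] -/
theorem six_mul_trace_restrict_descent (R J g : Equiv.Perm X) (hR : ∀ x, R (R (R x)) = x) (hJ : ∀ x, J (J x) = x)
    (hJR : ∀ x, J (R (J x)) = R (R x))
    (hgR : g * R = R * g) (hgJ : g * J = J * g) (h2 : (2 : K) ≠ 0) (h3 : (3 : K) ≠ 0) :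
    6 * LinearMap.trace K _ ((LinearMap.funLeft K K g).restrict (mapsTo_Y (K := K) hgR hgJ)) =
      2 * ((Finset.univ.filter fun x => g x = x).card : K) - ((Finset.univ.filter fun x => (R * g) x = x).card : K)
        - ((Finset.univ.filter fun x => (R * (R * g)) x = x).card : K) := by
  have hRg : ∀ x, R (g x) = g (R x) := fun x => by
    have := Equiv.ext_iff.mp hgR x; simpa using this.symm
  have hJg : ∀ x, J (g x) = g (J x) := fun x => by
    have := Equiv.ext_iff.mp hgJ x; simpa using this.symm
  have hR4 : ∀ x, R (R (R (R x))) = R x := fun x => hR (R x)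
  have hJR' : ∀ y, J (R y) = R (R (J y)) := fun y => by
    have := hJR (J y); rwa [hJ] at this
  have hJRR : ∀ y, J (R (R y)) = R (J y) := fun y => by
    rw [hJR' (R y), hJR' y, hR4]
  have half : ∀ a : K, (2 : K)⁻¹ * (a + a) = a := fun a => by
    rw [← two_mul, ← mul_assoc, inv_mul_cancel₀ h2, one_mul]
  -- the operators (opaque names via `set`)
  set r : Module.End K (X → K) := LinearMap.funLeft K K R with hr
  set j : Module.End K (X → K) := LinearMap.funLeft K K J with hj
  set γ : Module.End K (X → K) := LinearMap.funLeft K K g with hγ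
  set e₁ : Module.End K (X → K) := (3 : K)⁻¹ • (1 + r + r * r) with he₁
  set e₂ : Module.End K (X → K) := 1 - e₁ with he₂
  set ep : Module.End K (X → K) := (2 : K)⁻¹ • (1 + j) with hep
  set em : Module.End K (X → K) := (2 : K)⁻¹ • (1 - j) with hem
  set φ : Module.End K (X → K) := r - r * r with hφ
  -- pointwise descriptions
  have γ_ap : ∀ (f : X → K) x, γ f x = f (g x) := fun f x => rfl
  have e₂_ap : ∀ (f : X → K) x, e₂ f x = f x - (3 : K)⁻¹ * (f x + f (R x) + f (R (R x))) := fun f x => rfl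
  have ep_ap : ∀ (f : X → K) x, ep f x = (2 : K)⁻¹ * (f x + f (J x)) := fun f x => rfl
  have em_ap : ∀ (f : X → K) x, em f x = (2 : K)⁻¹ * (f x - f (J x)) := fun f x => rfl
  have φ_ap : ∀ (f : X → K) x, φ f x = f (R x) - f (R (R x)) := fun f x => rfl
  clear_value e₁ e₂ ep em φ
  -- (1) identities in End(K^X), proved pointwise
  have hφ2 : φ * φ = (-3 : K) • e₂ := by
    apply LinearMap.ext; intro f; funext x
    simp only [Module.End.mul_apply, LinearMap.smul_apply, Pi.smul_apply, smul_eq_mul, φ_ap, e₂_ap, hR]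
    field_simp
    ring
  have hφem : φ * em = ep * φ := by
    apply LinearMap.ext; intro f; funext x
    simp only [Module.End.mul_apply, φ_ap, em_ap, ep_ap, hJR', hR]
    ring
  have he₂em : e₂ * em = em * e₂ := by
    apply LinearMap.ext; intro f; funext x
    simp only [Module.End.mul_apply, e₂_ap, em_ap, hJR', hR]
    ring
  have he₂ep : e₂ * ep = ep * e₂ := by
    apply LinearMap.ext; intro f; funext x
    simp only [Module.End.mul_apply, e₂_ap, ep_ap, hJR', hR]
    ring
  have hγφ : γ * φ = φ * γ := by
    apply LinearMap.ext; intro f; funext x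
    simp only [Module.End.mul_apply, γ_ap, φ_ap, hRg]
  have hsum : ep + em = 1 := by
    apply LinearMap.ext; intro f; funext x
    simp only [LinearMap.add_apply, Pi.add_apply, ep_ap, em_ap, Module.End.one_apply]
    rw [← mul_add, show f x + f (J x) + (f x - f (J x)) = f x + f x by ring, half]
  have he₁e₂ : e₁ + e₂ = 1 := by rw [he₂]; abel
  have h33 : (-(3 : K)⁻¹) * (-3) = 1 := by rw [neg_mul_neg, inv_mul_cancel₀ h3]
  -- (2) tr(γ e₂ em) = tr(γ e₂ ep)
  have htr_em : LinearMap.trace K _ (γ * e₂ * em) = LinearMap.trace K _ (γ * e₂ * ep) := by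
    have h1 : γ * e₂ * em = (-(3 : K)⁻¹) • (γ * em * (φ * φ)) := by
      rw [hφ2, mul_smul_comm, smul_smul, h33, one_smul, mul_assoc, he₂em, ← mul_assoc]
    have h1' : γ * e₂ * ep = (-(3 : K)⁻¹) • (γ * ep * (φ * φ)) := by
      rw [hφ2, mul_smul_comm, smul_smul, h33, one_smul, mul_assoc, he₂ep, ← mul_assoc]
    have hcyc : LinearMap.trace K _ (γ * em * (φ * φ)) = LinearMap.trace K _ (γ * ep * (φ * φ)) := by
      calc LinearMap.trace K _ (γ * em * (φ * φ))
          = LinearMap.trace K _ ((γ * em * φ) * φ) := by simp only [mul_assoc]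
        _ = LinearMap.trace K _ (φ * (γ * em * φ)) := LinearMap.trace_mul_comm K _ _
        _ = LinearMap.trace K _ ((φ * γ) * em * φ) := by simp only [mul_assoc]
        _ = LinearMap.trace K _ ((γ * φ) * em * φ) := by rw [hγφ]
        _ = LinearMap.trace K _ (γ * (φ * em) * φ) := by simp only [mul_assoc]
        _ = LinearMap.trace K _ (γ * (ep * φ) * φ) := by rw [hφem]
        _ = LinearMap.trace K _ (γ * ep * (φ * φ)) := by simp only [mul_assoc]
    rw [h1, h1', map_smul, map_smul, hcyc]
  -- (3) tr(γ e₂) = 2 tr(γ e₂ ep)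
  have htr_e₂ : LinearMap.trace K _ (γ * e₂) = 2 * LinearMap.trace K _ (γ * e₂ * ep) := by
    have hdec : γ * e₂ = γ * e₂ * ep + γ * e₂ * em := by rw [← mul_add, hsum, mul_one]
    conv_lhs => rw [hdec]
    rw [map_add, htr_em, two_mul]
  -- (4) tr γ = tr(γ e₁) + tr(γ e₂) and 3 tr(γ e₁) = tr γ + tr γr + tr γr²
  have htr_split : LinearMap.trace K _ γ = LinearMap.trace K _ (γ * e₁) + LinearMap.trace K _ (γ * e₂) := by
    rw [← map_add, ← mul_add, he₁e₂, mul_one]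
  have htr_e₁ : 3 * LinearMap.trace K _ (γ * e₁) =
      LinearMap.trace K _ γ + LinearMap.trace K _ (γ * r) + LinearMap.trace K _ (γ * r * r) := by
    have : γ * e₁ = (3 : K)⁻¹ • (γ + γ * r + γ * r * r) := by
      rw [he₁, mul_smul_comm, mul_add, mul_add, mul_one, ← mul_assoc]
    rw [this, map_smul, map_add, map_add, smul_eq_mul, ← mul_assoc, mul_inv_cancel₀ h3, one_mul]
  -- (5) tr(γ e₂ ep) = tr(γ | Y): `γ e₂ ep` maps into `Y` and is `γ` on `Y`
  have hE_into : ∀ f : X → K, (γ * e₂ * ep) f ∈ (LinearMap.ker (1 + LinearMap.funLeft K K R + LinearMap.funLeft K K R * LinearMap.funLeft K K R : Module.End K (X → K)) ⊓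
        LinearMap.ker (LinearMap.funLeft K K J - 1 : Module.End K (X → K))) := by
    intro f
    rw [mem_Y]
    refine ⟨fun x => ?_, fun x => ?_⟩
    · simp only [Module.End.mul_apply, γ_ap, e₂_ap, ep_ap, ← hRg, hR]
      field_simp
      ring
    · simp only [Module.End.mul_apply, γ_ap, e₂_ap, ep_ap, ← hJg, hJ, hJR', hR]
      ring
  have hE_id : ∀ f ∈ (LinearMap.ker (1 + LinearMap.funLeft K K R + LinearMap.funLeft K K R * LinearMap.funLeft K K R : Module.End K (X → K)) ⊓
        LinearMap.ker (LinearMap.funLeft K K J - 1 : Module.End K (X → K))), (γ * e₂ * ep) f = γ f := by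
    intro f hf
    rw [mem_Y] at hf
    funext x
    simp only [Module.End.mul_apply, γ_ap, e₂_ap, ep_ap, hf.2, half]
    rw [hf.1 (g x), mul_zero, sub_zero]
  have htr_Y : LinearMap.trace K _ (γ * e₂ * ep) =
      LinearMap.trace K _ ((LinearMap.funLeft K K g).restrict (mapsTo_Y (K := K) hgR hgJ)) := by
    rw [← LinearMap.trace_restrict_eq_of_forall_mem _ (γ * e₂ * ep) hE_into (fun f _ => hE_into f)]
    congr 1
    apply LinearMap.ext
    intro f
    apply Subtype.ext
    simp only [LinearMap.coe_restrict_apply]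
    exact hE_id f.1 f.2
  -- (6) traces of the permutation operators
  have htrγ : LinearMap.trace K _ γ = ((Finset.univ.filter fun x => g x = x).card : K) := trace_funLeft_perm g
  have htrγr : LinearMap.trace K _ (γ * r) = ((Finset.univ.filter fun x => (R * g) x = x).card : K) := by
    rw [hγ, hr, ← funLeft_perm_mul]
    exact trace_funLeft_perm (R * g)
  have htrγrr : LinearMap.trace K _ (γ * r * r) = ((Finset.univ.filter fun x => (R * (R * g)) x = x).card : K) := by
    rw [hγ, hr, ← funLeft_perm_mul, ← funLeft_perm_mul, ← mul_assoc]
    exact trace_funLeft_perm _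
  -- assemble
  rw [← htr_Y]
  have key : 6 * LinearMap.trace K _ (γ * e₂ * ep) = 3 * LinearMap.trace K _ γ - 3 * LinearMap.trace K _ (γ * e₁) := by
    rw [htr_split, htr_e₂]
    ring
  rw [key, htr_e₁, htrγ, htrγr, htrγrr]
  ring

end Summit.BirchSwinnertonDyer.BirchSwinnertonDyer.Theorems.CartanSupply.DihedralDescent
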